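import Summits.Ventures.DiscreteObjects.STD.ClassFixing
import Summits.Ventures.DiscreteObjects.Hadamard.FixedStructure

/-!
# Symmetric transversal designs: the quotient by a class-fixing fixed-point-free automorphism of prime order (kernel)
Framing: lottery ticket; floor = certified bounds/negative ranges.

Cell pub-namedobj (venture DiscreteObjects), target (M), designs gen 9.  The census of STD₂[12;6] (the quotient of a
putative projective plane of order 12 by an involutory elation, family F-INV2) and its cover tower (FAMILY-ZCOVER §1: 'a
class-fixing automorphism is fixed-point-free and its quotient is again an STD') use the classical CLASS-REGULAR QUOTIENT
construction, which `ClassFixing.lean` only mentions in words.  This file proves it in the incidence-array vocabulary of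
`OrderFiveReduction` (`IncArray k u`, `IsSTD lam π`), for general parameters:

**`exists_classRegular_quotient`.**  Let `π : IncArray k u` satisfy `IsSTD lam π`, and let label permutations
`α i` (point classes) and `β j` (block classes) transport incidence, `π i j (α i a) = β j (π i j a)` (a class-fixing
automorphism), with `(α i) ^ e = 1` for a prime `e` and `α i a ≠ a` for every label (fixed-point-free on points).  Then
`e ∣ u`, and the orbit structure is an STD with parameters `(lam·e, k, u/e)`: there are an array `π' : IncArray k (u/e)`
with `IsSTD (lam * e) π'` and surjective quotient maps `qP i, qB j : Fin u → Fin (u/e)` whose fibres are exactly the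
`α i`- resp. `β j`-orbits, such that `π' i j (qP i a) = qB j (π i j a)` — the block through the image of a point is the
image of the block through the point.  (The `β j` are automatically fixed-point-free of order `e`: `beta_fpf`,
`beta_pow_eq_one`.)  Counting: two point-orbits of different classes `i ≠ i'` share the block-orbit of class `j` iff
`π i j ((α i)^t a) = π i' j b` for some `t < e`; for each `t` this happens for exactly `lam` classes `j` and for distinct
`t` never for the same `j` (`card_filter_exists_lt`), whence `lam · e`; dually for blocks.

Corollaries for the census (`IncArray 12 6`, `IsSTD 2`, with `ClassFixing.classFixing_fixedPointFree`): a non-trivial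
class-fixing array automorphism whose point-label maps square to the identity yields a quotient STD₄[12;3]
(`exists_quotient_STD4_of_classFixing_involution`), and one whose point-label maps cube to the identity yields an
STD₆[12;2] (`exists_quotient_STD6_of_classFixing_order3`) — the kernel form of the first sentence of FAMILY-ZCOVER §1
(the GF(2) / Z₃ voltage conditions of the cover are not formalised here).  Classical (Jungnickel 1982, class-regular
STDs); formalisation ours; no `sorry`.
-/

namespace Summit.Ventures.DiscreteObjects.STD

open Finset Equiv Summit.Ventures.DiscreteObjects.PP12 Summit.Ventures.DiscreteObjects.Hadamard

/-! ### A counting lemma: disjoint cases -/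

section Counting

/-- If for each `t < e` exactly `lam` elements satisfy `Q t`, and no element satisfies `Q t` and `Q s` for `t ≠ s`,
then exactly `lam * e` elements satisfy `Q t` for some `t < e`. -/
theorem card_filter_exists_lt {ι : Type*} [Fintype ι] [DecidableEq ι] (e lam : ℕ) (Q : ℕ → ι → Prop)
    [∀ t x, Decidable (Q t x)] (hcard : ∀ t < e, (univ.filter (Q t)).card = lam)
    (hdisj : ∀ t < e, ∀ s < e, ∀ x, Q t x → Q s x → t = s) :
    (univ.filter fun x => ∃ t < e, Q t x).card = lam * e := by
  have hset : (univ.filter fun x => ∃ t < e, Q t x) = (range e).biUnion fun t => univ.filter (Q t) := by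
    ext x
    simp only [mem_filter, mem_univ, true_and, mem_biUnion, mem_range]
  rw [hset, card_biUnion]
  · rw [sum_congr rfl fun t ht => hcard t (mem_range.mp ht), sum_const, card_range, smul_eq_mul, mul_comm]
  · intro t ht s hs hts
    rw [Function.onFun, disjoint_left]
    intro x hxt hxs
    exact hts (hdisj t (mem_range.mp ht) s (mem_range.mp hs) x (mem_filter.mp hxt).2 (mem_filter.mp hxs).2)

end Counting

/-! ### Orbits of a fixed-point-free permutation of prime order -/

section Orbits

variable {u e : ℕ} (τ : Perm (Fin u))

/-- membership in an orbit: `b ∈ orbFin τ e a ↔ (τ^t) a = b` for some `t < e` -/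
theorem mem_orbFin_iff {a b : Fin u} : b ∈ orbFin τ e a ↔ ∃ t < e, (τ ^ t) a = b := by
  unfold orbFin
  simp only [mem_image, mem_range]

/-- for a fixed-point-free `τ` every orbit is one of the classes -/
theorem orbFin_mem_blockClasses (hfpf : ∀ a, τ a ≠ a) (a : Fin u) : orbFin τ e a ∈ blockClasses τ e :=
  mem_image_of_mem _ (mem_filter.mpr ⟨mem_univ _, hfpf a⟩)

/-- two orbits of a fixed-point-free permutation of prime order coincide iff the second base point lies in the first
orbit -/
theorem orbFin_eq_iff (he : e.Prime) (hτ : τ ^ e = 1) (hfpf : ∀ a, τ a ≠ a) {a b : Fin u} :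
    orbFin τ e a = orbFin τ e b ↔ b ∈ orbFin τ e a := by
  constructor
  · intro h; rw [h]; exact mem_orbFin_self τ he.pos b
  · intro h; exact (orbFin_eq_of_mem τ he hτ (hfpf a) h).symm

/-- a fixed-point-free permutation of prime order `e` of `Fin u` has exactly `u / e` orbits, and `e ∣ u` -/
theorem card_blockClasses_of_fpf (he : e.Prime) (hτ : τ ^ e = 1) (hfpf : ∀ a, τ a ≠ a) :
    e ∣ u ∧ (blockClasses τ e).card = u / e := by
  have h := card_fixed_add_classes τ he hτ
  have h0 : (univ.filter fun a => τ a = a).card = 0 := by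
    rw [card_eq_zero, filter_eq_empty_iff]
    intro a _; exact hfpf a
  rw [h0, zero_add, Fintype.card_fin] at h
  refine ⟨⟨(blockClasses τ e).card, by rw [mul_comm]; exact h.symm⟩, ?_⟩
  exact (Nat.div_eq_of_eq_mul_left he.pos h.symm).symm

end Orbits

/-! ### The class-regular quotient -/

section Quotient

variable {k u lam e : ℕ} (π : IncArray k u) (α β : Fin k → Perm (Fin u))

/-- incidence transport iterates: `π i j ((α i)^t a) = (β j)^t (π i j a)` -/
theorem inc_pow (hinc : ∀ i j a, π i j (α i a) = β j (π i j a)) (i j : Fin k) (t : ℕ) (a : Fin u) :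
    π i j ((α i ^ t) a) = (β j ^ t) (π i j a) := by
  induction t generalizing a with
  | zero => simp
  | succ t ih => rw [pow_succ, Perm.mul_apply, ih, hinc, ← Perm.mul_apply, ← pow_succ]

/-- the inverse form: `(α i)^t ((π i j)⁻¹ c) = (π i j)⁻¹ ((β j)^t c)` -/
theorem pow_symm_apply (hinc : ∀ i j a, π i j (α i a) = β j (π i j a)) (i j : Fin k) (t : ℕ) (c : Fin u) :
    (α i ^ t) ((π i j).symm c) = (π i j).symm ((β j ^ t) c) := by
  rw [Equiv.eq_symm_apply, inc_pow π α β hinc, Equiv.apply_symm_apply]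

/-- the block-label maps are fixed-point-free as soon as the point-label maps are -/
theorem beta_fpf (hinc : ∀ i j a, π i j (α i a) = β j (π i j a)) (hfpf : ∀ i a, α i a ≠ a) (j : Fin k)
    (b : Fin u) : β j b ≠ b := by
  intro hb
  apply hfpf j ((π j j).symm b)
  apply (π j j).injective
  rw [hinc, Equiv.apply_symm_apply, hb]

/-- the block-label maps satisfy `(β j)^e = 1` as soon as the point-label maps do -/
theorem beta_pow_eq_one (hinc : ∀ i j a, π i j (α i a) = β j (π i j a)) (hα : ∀ i, α i ^ e = 1) (j : Fin k) :
    β j ^ e = 1 := by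
  ext b
  have h := inc_pow π α β hinc j j e ((π j j).symm b)
  rw [hα j, Perm.one_apply, Equiv.apply_symm_apply] at h
  simpa using congrArg Fin.val h.symm

/-- the image of a point-orbit under `π i j` is the block-orbit of the image -/
theorem image_orbFin (hinc : ∀ i j a, π i j (α i a) = β j (π i j a)) (i j : Fin k) (a : Fin u) :
    (orbFin (α i) e a).image (π i j) = orbFin (β j) e (π i j a) := by
  unfold orbFin
  rw [image_image]
  refine image_congr fun t _ => ?_
  simp only [Function.comp_apply]
  exact inc_pow π α β hinc i j t a

/-- **The class-regular quotient of an STD (kernel).**  See the module docstring. -/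
theorem exists_classRegular_quotient (hk : 0 < k) (hπ : IsSTD lam π) (he : e.Prime)
    (hinc : ∀ i j a, π i j (α i a) = β j (π i j a)) (hα : ∀ i, α i ^ e = 1) (hfpf : ∀ i a, α i a ≠ a) :
    e ∣ u ∧ ∃ (π' : IncArray k (u / e)) (qP qB : Fin k → Fin u → Fin (u / e)),
      IsSTD (lam * e) π' ∧ (∀ i, Function.Surjective (qP i)) ∧ (∀ j, Function.Surjective (qB j)) ∧
      (∀ i a a', qP i a = qP i a' ↔ ∃ t < e, (α i ^ t) a = a') ∧
      (∀ j b b', qB j b = qB j b' ↔ ∃ t < e, (β j ^ t) b = b') ∧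
      (∀ i j a, π' i j (qP i a) = qB j (π i j a)) := by
  have hβfpf : ∀ j b, β j b ≠ b := beta_fpf π α β hinc hfpf
  have hβ : ∀ j, β j ^ e = 1 := beta_pow_eq_one π α β hinc hα
  -- orbit classes and their number
  have hcP : ∀ i, (blockClasses (α i) e).card = u / e := fun i =>
    (card_blockClasses_of_fpf (α i) he (hα i) (hfpf i)).2
  have hcB : ∀ j, (blockClasses (β j) e).card = u / e := fun j =>
    (card_blockClasses_of_fpf (β j) he (hβ j) (hβfpf j)).2
  have hdvd : e ∣ u := (card_blockClasses_of_fpf (α ⟨0, hk⟩) he (hα _) (hfpf _)).1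
  -- equivalences from the orbit sets to `Fin (u/e)`
  let EP : ∀ i, {O // O ∈ blockClasses (α i) e} ≃ Fin (u / e) := fun i =>
    Fintype.equivFinOfCardEq (by rw [Fintype.card_coe, hcP i])
  let EB : ∀ j, {O // O ∈ blockClasses (β j) e} ≃ Fin (u / e) := fun j =>
    Fintype.equivFinOfCardEq (by rw [Fintype.card_coe, hcB j])
  -- quotient maps
  let qP : Fin k → Fin u → Fin (u / e) := fun i a => EP i ⟨orbFin (α i) e a, orbFin_mem_blockClasses _ (hfpf i) a⟩
  let qB : Fin k → Fin u → Fin (u / e) := fun j b => EB j ⟨orbFin (β j) e b, orbFin_mem_blockClasses _ (hβfpf j) b⟩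
  have qP_eq : ∀ i a a', qP i a = qP i a' ↔ ∃ t < e, (α i ^ t) a = a' := by
    intro i a a'
    rw [← mem_orbFin_iff, ← orbFin_eq_iff (α i) he (hα i) (hfpf i)]
    simp only [qP, EmbeddingLike.apply_eq_iff_eq, Subtype.mk.injEq]
  have qB_eq : ∀ j b b', qB j b = qB j b' ↔ ∃ t < e, (β j ^ t) b = b' := by
    intro j b b'
    rw [← mem_orbFin_iff, ← orbFin_eq_iff (β j) he (hβ j) (hβfpf j)]
    simp only [qB, EmbeddingLike.apply_eq_iff_eq, Subtype.mk.injEq]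
  have qP_surj : ∀ i, Function.Surjective (qP i) := by
    intro i a'
    obtain ⟨a, -, ha⟩ := mem_image.mp ((EP i).symm a').2
    refine ⟨a, ?_⟩
    show EP i ⟨orbFin (α i) e a, _⟩ = a'
    rw [← Equiv.apply_symm_apply (EP i) a']
    congr 1
    exact Subtype.ext ha
  have qB_surj : ∀ j, Function.Surjective (qB j) := by
    intro j b'
    obtain ⟨b, -, hb⟩ := mem_image.mp ((EB j).symm b').2
    refine ⟨b, ?_⟩
    show EB j ⟨orbFin (β j) e b, _⟩ = b'
    rw [← Equiv.apply_symm_apply (EB j) b']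
    congr 1
    exact Subtype.ext hb
  -- the induced map on orbits, class by class
  let f : ∀ i j, {O // O ∈ blockClasses (α i) e} → {O // O ∈ blockClasses (β j) e} := fun i j O =>
    ⟨O.1.image (π i j), by
      obtain ⟨a, -, ha⟩ := mem_image.mp O.2
      rw [← ha, image_orbFin π α β hinc]
      exact orbFin_mem_blockClasses _ (hβfpf j) _⟩
  have f_inj : ∀ i j, Function.Injective (f i j) := by
    intro i j O O' h
    apply Subtype.ext
    exact Finset.image_injective (π i j).injective (congrArg Subtype.val h)
  have f_bij : ∀ i j, Function.Bijective (f i j) := fun i j =>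
    (Fintype.bijective_iff_injective_and_card (f i j)).mpr
      ⟨f_inj i j, by rw [Fintype.card_coe, Fintype.card_coe, hcP, hcB]⟩
  let π' : IncArray k (u / e) := fun i j => ((EP i).symm.trans (Equiv.ofBijective (f i j) (f_bij i j))).trans (EB j)
  have key : ∀ i j a, π' i j (qP i a) = qB j (π i j a) := by
    intro i j a
    simp only [π', qP, qB, Equiv.trans_apply, Equiv.symm_apply_apply, Equiv.ofBijective_apply]
    congr 1
    apply Subtype.ext
    simp only [f]
    exact image_orbFin π α β hinc i j a
  have key_symm : ∀ i j c, (π' i j).symm (qB j c) = qP i ((π i j).symm c) := by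
    intro i j c
    rw [Equiv.symm_apply_eq, key, Equiv.apply_symm_apply]
  refine ⟨hdvd, π', qP, qB, ⟨?_, ?_⟩, qP_surj, qB_surj, qP_eq, qB_eq, key⟩
  · -- λ' = lam * e on points
    intro i i' hii' a₀ b₀
    obtain ⟨a, rfl⟩ := qP_surj i a₀
    obtain ⟨b, rfl⟩ := qP_surj i' b₀
    have hQ : (univ.filter fun j => π' i j (qP i a) = π' i' j (qP i' b)) =
        univ.filter fun j => ∃ t < e, π i j ((α i ^ t) a) = π i' j b := by
      refine filter_congr fun j _ => ?_
      rw [key, key, qB_eq]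
      refine exists_congr fun t => and_congr_right fun _ => ?_
      rw [inc_pow π α β hinc]
    rw [hQ]
    refine card_filter_exists_lt e lam _ (fun t _ => hπ.1 i i' hii' _ b) fun t ht s hs j hjt hjs => ?_
    have h := hjt.trans hjs.symm
    exact perm_pow_apply_injective (α i) he (hα i) (hfpf i a) ht hs ((π i j).injective h)
  · -- λ' = lam * e on blocks
    intro j j' hjj' c₀ d₀
    obtain ⟨c, rfl⟩ := qB_surj j c₀
    obtain ⟨d, rfl⟩ := qB_surj j' d₀
    have hQ : (univ.filter fun i => (π' i j).symm (qB j c) = (π' i j').symm (qB j' d)) =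
        univ.filter fun i => ∃ t < e, (π i j).symm ((β j ^ t) c) = (π i j').symm d := by
      refine filter_congr fun i _ => ?_
      rw [key_symm, key_symm, qP_eq]
      refine exists_congr fun t => and_congr_right fun _ => ?_
      rw [pow_symm_apply π α β hinc]
    rw [hQ]
    refine card_filter_exists_lt e lam _ (fun t _ => hπ.2 j j' hjj' _ d) fun t ht s hs i hit his => ?_
    have h := hit.trans his.symm
    exact perm_pow_apply_injective (β j) he (hβ j) (hβfpf j c) ht hs ((π i j).symm.injective h)

end Quotient

/-! ### The census instances: quotients of an STD₂[12;6] by a class-fixing involution / automorphism of order 3 -/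

section Census

variable (π : IncArray 12 6) (τ : ArrayAut π)

/-- a class-fixing array automorphism transports incidence label-wise -/
theorem inc_of_classFixing (hσ1 : ∀ i, τ.σ i = i) (hρ1 : ∀ j, τ.ρ j = j) (i j : Fin 12) (a : Fin 6) :
    π i j (τ.α i a) = τ.β j (π i j a) := by
  have h := τ.map_inc i j a
  rwa [hσ1 i, hρ1 j] at h

/-- **STD₂[12;6] → STD₄[12;3].**  A non-trivial class-fixing automorphism of an STD₂[12;6] whose point-label maps are
involutions is fixed-point-free, and the orbit structure is an STD₄[12;3] of which the STD₂[12;6] is a double cover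
(FAMILY-ZCOVER §1, first sentence, kernel). -/
theorem exists_quotient_STD4_of_classFixing_involution (hπ : IsSTD 2 π) (hσ1 : ∀ i, τ.σ i = i)
    (hρ1 : ∀ j, τ.ρ j = j) (hne : ¬ ∀ i, τ.α i = 1) (h2 : ∀ i, τ.α i ^ 2 = 1) :
    ∃ (π' : IncArray 12 3) (qP qB : Fin 12 → Fin 6 → Fin 3),
      IsSTD 4 π' ∧ (∀ i, Function.Surjective (qP i)) ∧ (∀ j, Function.Surjective (qB j)) ∧
      (∀ i a a', qP i a = qP i a' ↔ ∃ t < 2, (τ.α i ^ t) a = a') ∧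
      (∀ j b b', qB j b = qB j b' ↔ ∃ t < 2, (τ.β j ^ t) b = b') ∧
      (∀ i j a, π' i j (qP i a) = qB j (π i j a)) :=
  (exists_classRegular_quotient π τ.α τ.β (by norm_num) hπ Nat.prime_two (inc_of_classFixing π τ hσ1 hρ1) h2
    (classFixing_fixedPointFree π τ hπ hσ1 hρ1 hne)).2

/-- **STD₂[12;6] → STD₆[12;2].**  The same for a non-trivial class-fixing automorphism whose point-label maps have
order dividing `3`: the orbit structure is an STD₆[12;2] (triple cover; the ZC-3 cell of the census). -/
theorem exists_quotient_STD6_of_classFixing_order3 (hπ : IsSTD 2 π) (hσ1 : ∀ i, τ.σ i = i)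
    (hρ1 : ∀ j, τ.ρ j = j) (hne : ¬ ∀ i, τ.α i = 1) (h3 : ∀ i, τ.α i ^ 3 = 1) :
    ∃ (π' : IncArray 12 2) (qP qB : Fin 12 → Fin 6 → Fin 2),
      IsSTD 6 π' ∧ (∀ i, Function.Surjective (qP i)) ∧ (∀ j, Function.Surjective (qB j)) ∧
      (∀ i a a', qP i a = qP i a' ↔ ∃ t < 3, (τ.α i ^ t) a = a') ∧
      (∀ j b b', qB j b = qB j b' ↔ ∃ t < 3, (τ.β j ^ t) b = b') ∧
      (∀ i j a, π' i j (qP i a) = qB j (π i j a)) :=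
  (exists_classRegular_quotient π τ.α τ.β (by norm_num) hπ Nat.prime_three (inc_of_classFixing π τ hσ1 hρ1) h3
    (classFixing_fixedPointFree π τ hπ hσ1 hρ1 hne)).2

end Census

end Summit.Ventures.DiscreteObjects.STD
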